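import Summits.RiemannHypothesis.RiemannHypothesis.Theses.WeilSemilocal
import Summits.RiemannHypothesis.RiemannHypothesis.Theorems.HandoffDodgerSmallCeiling
import HarnessLib

/-!
# Route `WeilSemilocal` — the TAIL support item `SemilocalWallsFromSixtyThousand` (RH-FREE)

Item stmt-RiemannHypothesis-19097 of `route-RiemannHypothesis-WeilSemilocal`: C-I(a) at every prime `q ≥ 60 000` — for every
prime `q' > q`, `a*(S_q) = weilSemilocalThreshold (Nat.primesBelow q) < (log q')/2`.  This is VERBATIM the statement of
`Handoff.classLaw_from_sixtyThousand` (Theorems/HandoffDodgerSmallCeiling.lean, handoff-prove-2 ATTEMPT-21, p410077: the mollified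
zero-dodger zero-sum family `Handoff.SubwindowZeroSumFamily (1/5) 60000` gives the upper clause UC(q) at every prime `q ≥ 60 000`
through the family's own window clause, no rate condition), with `q` explicit.  One-line closer.  Nothing here bears on the truth
of RH (UPPER clauses of truncated Weil forms only; cell `rh-explicit`, typing lane cc-s2-1 gen20).
-/

set_option linter.dupNamespace false  -- the mandated namespace repeats `RiemannHypothesis`

namespace Summit.RiemannHypothesis.RiemannHypothesis.Theorems.WeilSemilocalRoute

open Summit.RiemannHypothesis.RiemannHypothesis.Theorems

/-- **TAIL of route `WeilSemilocal`** (item stmt-RiemannHypothesis-19097): C-I(a) at every prime `q ≥ 60 000`, from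
`Handoff.classLaw_from_sixtyThousand` (ATTEMPT-21, p410077). [this cell; zero counting as in arXiv:2102.04663] -/
theorem semilocalWallsFromSixtyThousand_proof :
    Summit.RiemannHypothesis.RiemannHypothesis.Theses.WeilSemilocal.SemilocalWallsFromSixtyThousand := by
  unfold Theses.WeilSemilocal.SemilocalWallsFromSixtyThousand
  intro q hq h60
  exact Handoff.classLaw_from_sixtyThousand hq h60

end Summit.RiemannHypothesis.RiemannHypothesis.Theorems.WeilSemilocalRoute
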